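import Summits.AtomisticToContinuum.HydrodynamicLimit.Theorems.LambertianContactSwapLambertianEulerInBandOfHearts
import HarnessLib

/-!
# Census sketch (crux-strategist, stmt-AtomisticToContinuum-11854): the signatures quoted in STRATEGY-CENSUS.md
§Strengthen (`LambertianEulerAllBands`, and why it buys nothing for the residual) and §Negation (the typed close-packing
obstruction and the dense-excursion level it would need).  Statements elaborate; the two `theorem`s are the trivial
implications quoted in the census.  Nothing here is an item.
-/

namespace Summit.AtomisticToContinuum.HydrodynamicLimit.Cruxes.LambertianEuler.StrategistCensus

open scoped BigOperators Topology Classical MeasureTheory ProbabilityTheory InnerProductSpace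
open Filter Set Function MeasureTheory
open Summit.AtomisticToContinuum.HydrodynamicLimit.Theorems.LambertianContactSwapLambertianEulerHeartsLog (LambertianEulerInBand)
open Summit.AtomisticToContinuum.HydrodynamicLimit.Theses.ImplosionDichotomy (DiluteSelfConsistency DenseExcursion)

/-- §Strengthen, S⁺: the guarded Euler limit of `Λ` in EVERY band (`∀ η₀ > 0` in place of `∃ η₀ > 0`; the rest verbatim
`LambertianEulerInBand`). Stronger than the child; for `η₀` beyond the fluid range it is a statement about dense / jammed
hard spheres with the junk branch of `hsCompressibility`, i.e. not credible, and (below) it still needs `DiluteSelfConsistency`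
at SOME level to reach the unguarded crux. -/
def LambertianEulerAllBands : Prop :=
  ∀ η₀ : ℝ, 0 < η₀ → ∀ (a₀ θ₀ : Literature.MathematicalPhysics.KineticTheory.T3 → ℝ) (u₀ : Literature.MathematicalPhysics.KineticTheory.T3 → Literature.MathematicalPhysics.KineticTheory.V3), Continuous a₀ → Continuous θ₀ → Continuous u₀ → (∀ x, 0 < a₀ x) → (∀ x, 0 < θ₀ x) → ∃ σ₀ : ℝ, 0 < σ₀ ∧ ∀ σ : ℝ, 0 < σ → σ < σ₀ → ∀ (T : ℝ) (ρ θ : ℝ → Literature.MathematicalPhysics.KineticTheory.T3 → ℝ) (u : ℝ → Literature.MathematicalPhysics.KineticTheory.T3 → Literature.MathematicalPhysics.KineticTheory.V3), Literature.MathematicalPhysics.KineticTheory.IsHardSphereEulerSolution σ T ρ u θ → (∀ t ∈ Set.Ico 0 T, ∀ x, ρ t x * σ ^ 3 < η₀) → ∀ Φ : (N : ℕ) → Literature.Analysis.FluidPDE.HardSphereFlow (Literature.Analysis.FluidPDE.Torus.geometry (Fin 3)) (Literature.MathematicalPhysics.KineticTheory.hsDiameter σ N) (N + 1), Literature.MathematicalPhysics.KineticTheory.TendstoHydroFieldsAt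 (fun N => Literature.MathematicalPhysics.KineticTheory.localGibbsLaw σ a₀ u₀ θ₀ N (Φ N)) Φ ρ u θ 0 → ∀ t ∈ Set.Ico 0 T, ∀ χ : Literature.MathematicalPhysics.KineticTheory.T3 → ℝ, Continuous χ → ∀ δ > (0 : ℝ), Filter.Tendsto (fun N : ℕ => ((Literature.MathematicalPhysics.KineticTheory.localGibbsLaw σ a₀ u₀ θ₀ N (Φ N)).prod (Literature.MathematicalPhysics.KineticTheory.lambertNoise (Fin 3))) {p | δ < |Literature.MathematicalPhysics.KineticTheory.empiricalDensityField (Literature.MathematicalPhysics.KineticTheory.lambertFlow (Literature.Analysis.FluidPDE.Torus.geometry (Fin 3)) (Literature.MathematicalPhysics.KineticTheory.hsDiameter σ N) p.2 p.1 t) χ - ∫ x, χ x * ρ t x|}) Filter.atTop (nhds 0) ∧ Filter.Tendsto (fun N : ℕ => ((Literature.MathematicalPhysics.KineticTheory.localGibbsLaw σ a₀ u₀ θ₀ N (Φ N)).prod (Literature.MathematicalPhysics.KineticTheory.lambertNoise (Fin 3))) {p | δ < ‖Literature.MathematicalPhysics.KineticTheory.empiricalMomentumField (Literature.MathematicalPhysics.KineticTheory.lambertFlow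 (Literature.Analysis.FluidPDE.Torus.geometry (Fin 3)) (Literature.MathematicalPhysics.KineticTheory.hsDiameter σ N) p.2 p.1 t) χ - ∫ x, (χ x * ρ t x) • u t x‖}) Filter.atTop (nhds 0) ∧ Filter.Tendsto (fun N : ℕ => ((Literature.MathematicalPhysics.KineticTheory.localGibbsLaw σ a₀ u₀ θ₀ N (Φ N)).prod (Literature.MathematicalPhysics.KineticTheory.lambertNoise (Fin 3))) {p | δ < |Literature.MathematicalPhysics.KineticTheory.empiricalEnergyField (Literature.MathematicalPhysics.KineticTheory.lambertFlow (Literature.Analysis.FluidPDE.Torus.geometry (Fin 3)) (Literature.MathematicalPhysics.KineticTheory.hsDiameter σ N) p.2 p.1 t) χ - ∫ x, χ x * Literature.MathematicalPhysics.KineticTheory.totalEnergyDensity (ρ t x) (u t x) (θ t x)|}) Filter.atTop (nhds 0)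

/-- S⁺ ⇒ the child (instantiate any band). [folklore] -/
theorem inBand_of_allBands (h : LambertianEulerAllBands) : LambertianEulerInBand :=
  ⟨1, one_pos, h 1 one_pos⟩

/-- S⁺ still reaches the UNGUARDED crux only through dilute self-consistency at some level (here through the child and the
lead's glue): the added rigidity buys nothing for the residual. [folklore] -/
theorem lambertianEuler_of_allBands (h : LambertianEulerAllBands) (hD : DiluteSelfConsistency) :
    Summit.AtomisticToContinuum.HydrodynamicLimit.Theses.LambertianContactSwap.LambertianEuler :=
  Summit.AtomisticToContinuum.HydrodynamicLimit.Theorems.LambertianContactSwapLambertianEulerInBandOfHearts.lambertianEuler_of_inBand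
    (inBand_of_allBands h) hD

/-- §Negation: the dense-excursion LEVEL a counterexample to the unguarded crux would need — a tied admissible classical
hs-Euler solution whose density exceeds `2/σ³ > (6/π)/σ³` on an open ball at some `t ∈ (0,T)` (beyond what ANY configuration of
`N+1` disjoint balls of diameter `σ(N+1)^(-1/3)` can realise, by the trivial volume bound — no Kepler constant needed).  Compare
`ImplosionDichotomy.DenseExcursion` (stmt-12586: SOME level `η > 0`; numerically true with central packing ≈ 0.5 before the shock). -/
def DenseExcursionBeyondClosePacking : Prop :=
  ∃ (a₀ θ₀ : Literature.MathematicalPhysics.KineticTheory.T3 → ℝ) (u₀ : Literature.MathematicalPhysics.KineticTheory.T3 → Literature.MathematicalPhysics.KineticTheory.V3), Continuous a₀ ∧ Continuous θ₀ ∧ Continuous u₀ ∧ (∀ x, 0 < a₀ x) ∧ (∀ x, 0 < θ₀ x) ∧ ∀ σ₀ : ℝ, 0 < σ₀ → ∃ σ : ℝ, 0 < σ ∧ σ < σ₀ ∧ ∃ (T : ℝ) (ρ θ : ℝ → Literature.MathematicalPhysics.KineticTheory.T3 → ℝ) (u : ℝ → Literature.MathematicalPhysics.KineticTheory.T3 →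 Literature.MathematicalPhysics.KineticTheory.V3), Literature.MathematicalPhysics.KineticTheory.IsHardSphereEulerSolution σ T ρ u θ ∧ (∀ Φ : (N : ℕ) → Literature.Analysis.FluidPDE.HardSphereFlow (Literature.Analysis.FluidPDE.Torus.geometry (Fin 3)) (Literature.MathematicalPhysics.KineticTheory.hsDiameter σ N) (N + 1), Literature.MathematicalPhysics.KineticTheory.TendstoHydroFieldsAt (fun N => Literature.MathematicalPhysics.KineticTheory.localGibbsLaw σ a₀ u₀ θ₀ N (Φ N)) Φ ρ u θ 0) ∧ ∃ t ∈ Set.Ioo 0 T, ∃ x, ∃ r : ℝ, 0 < r ∧ ∀ y, dist y x < r → 2 ≤ ρ t y * σ ^ 3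

/-- The would-be Negative lemma of §Negation (NOT proved here; recorded as the typed obstruction): an excursion beyond close
packing refutes the unguarded crux, because the empirical density field of a hard-core configuration tested against a bump on the
ball is at most `(6/π + o(1))·vol/σ³` while the Euler value is `≥ 2·vol/σ³`. -/
def ClosePackingRefutesLambertianEuler : Prop :=
  DenseExcursionBeyondClosePacking → ¬ Summit.AtomisticToContinuum.HydrodynamicLimit.Theses.LambertianContactSwap.LambertianEuler

end Summit.AtomisticToContinuum.HydrodynamicLimit.Cruxes.LambertianEuler.StrategistCensus
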